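import Summits.QuantumFields.YangMills.Theorems.BalabanUVNodesN15TwoSpacingGluingNeumannKnitEntryTwo
import Summits.QuantumFields.YangMills.Theorems.BalabanUVNodesN15TwoSpacingGluingRecordKnitEntryOne
import HarnessLib

/-!
# THE GLUING STEP AT TWO LATTICE SPACINGS, LXVIII: THE «G∇*» ENTRY OF THE RECORD COVER's PARAMETRIX — `G̃ ∘ ∇*_ν ≤ A·e^{−δ|y−y′|_T}` on the torus of record, VOLUME FREE
# (dag-n15-c g14, FILE 111 = 89R; N15 = NE2, s1 «background-layer OPERATOR ingredient»)

Cell `pub-ymgap`, seat `pub-ymgap-dag-n15-c` (R134 (a); HUMAN RULING D-0062), generation 14.  `bears_on: R4∕N15 · K3⁸ SpineGivenEndpointR13SepCoPHV (stmt-QuantumFields-27366)`.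
Filed `--supports stmt-QuantumFields-27366 --as helper` — COUNT-NEUTRAL.  Theorems only (0 `def`, 0 `sorry`).  Imports BY NAME FILE 89 `…NeumannKnitEntryTwo` (`coverH_shift_support`; through it
FILE 83 `hasMaj_parametrix_comp_cut`, FILE 65 `hcube_cut`, FILE 67 letters, FILE 72) and FILE 109 `…RecordKnitEntryOne` (FILE 73's cover; programme P: P-IIb `hasMaj_chiCube_liftCubeG`, P-IIj
`chiCube_liftCubeG_comp_divAdj_mulOp` ∕ `hasMaj_transplant_gDivAdj_pair`, `mem_cubeW`); nothing in the tree is modified.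

WHAT.  ★★ **`hasMaj_parametrix_divAdj_knitR`** — the record twin of FILE 89 `hasMaj_parametrix_divAdj_knit`: for odd `L ≥ 3`, `a > 0` there are `δ, A > 0` such that for all `s`,
`m_T ≥ s + 1`, `K ≥ 1`, `ν`, on `MP (paramsOf d L m_T K hL)` with FILE 73's cover, `G̃ ∘ ∇*_ν ≤ A·e^{−δ|y−y′|_T}` at the spacing `L^{−K}` — row 5 of FILE 50's `GluedLetters` ON THE TORUS OF
RECORD, `A, δ` free of `s`, of the volume `m_T`, of `K`: FILE 83's engine with the TRUE overlap `(L+1)^{d+1}`, P-IIb's cut rows, and the LIFTED sandwiched entry-2 rows (P-IIj's transplant, the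
sandwich identity `χ_□∘G^{↑}∘∇*_ν∘M_{h∘e_ν} = transplant(Sym′∘G′∇*′_ν∘M_{χ′})∘M_{h∘e_ν}` = P-IIj `chiCube_liftCubeG_comp_divAdj_mulOp` behind FILE 89's shifted-partition support).

HONEST FRAMING ∕ LIMITS.  Block-majorant bookkeeping over LANDED rows; `U ≡ 1` MODEL of [B6] §2's machine on the torus of record (cube letters from each cube's own doubled torus via programme
P: not circular in the volume); constants crude and ours; nothing of [B5]∕[B6] (2.38)–(2.40)∕[B9] Thm 3.1, 3.14 asserted.  NE2⁺ NOT PRINTED, NOT proved; N15 NOT discharged; counts of record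
UNMOVED (typed 28∕28 · discharged 5∕27); one finite 𝕋⁴ at fixed ε per index — NOT infinite volume, NOT OS on ℝ⁴, NOT a mass gap, NOT Clay; R4 closes `BalabanLadder.UV` only.  Restate-immune.
-/

noncomputable section

namespace Summit.QuantumFields.YangMills.BalabanUVNodes.N15.Gluing

open Real
open Literature.MathematicalPhysics.QuantumFieldTheory.Balaban1983to89
open Literature.MathematicalPhysics.QuantumFieldTheory.Balaban1983to89.B5Prop11Plancherel (Tor fine unitVec)
open Literature.MathematicalPhysics.QuantumFieldTheory.Balaban1983to89.B11SectG (BlockNorm HasMaj RowSum)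
open Literature.MathematicalPhysics.QuantumFieldTheory.Balaban1983to89.B6Prop26Gluing (mulOp mulOp_apply ind ind_nonneg ind_le_one)
open Literature.MathematicalPhysics.QuantumFieldTheory.Balaban1983to89.B6Prop26ReachTransplant (transplant)
open Literature.MathematicalPhysics.QuantumFieldTheory.Balaban1983to89.B6UnitTorusCarrier (unitTorusGeo)
open Literature.MathematicalPhysics.QuantumFieldTheory.Balaban1983to89.B5SiteBridgeP12 (MP)
open Literature.MathematicalPhysics.QuantumFieldTheory.King1986.Torus (blockOf tdistT tdistT_nonneg)
open Summit.QuantumFields.YangMills.BalabanUVNodes.N15.VectorPiece (bshiftEquiv kingPrV blkFine)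
open Summit.QuantumFields.YangMills.BalabanUVNodes.N15.BackgroundLayer (fgrad fgradAdj mulOp_comp_fgradAdj symbOp_sTinv_sub_one_eq)
open Summit.QuantumFields.YangMills.BalabanUVNodes.N15.TwoGrid (paramsOf gOp symOp symbOp sTinv chiCube cubeBlocks cubeW liftCubeG MP_dvd_MP torRed redBond mem_cubeW
  hasMaj_chiCube_liftCubeG chiCube_liftCubeG_comp_divAdj_mulOp hasMaj_transplant_gDivAdj_pair)

variable {d : ℕ}

section OneGrid

variable {L : ℕ} [NeZero L]

/-- ★★ **THE ENTRY «G∇*» OF THE RECORD COVER's PARAMETRIX, VOLUME FREE** — the record twin of FILE 89: for odd `L ≥ 3`, `a > 0` there are `δ, A > 0` with, for all `s`, `m_T ≥ s + 1`, `K ≥ 1`,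
`ν`, on `MP (paramsOf d L m_T K hL)` with FILE 73's cover (`knitGR`: LIFTED Neumann cubes of side `L^{s+1}`; `knitHR`), `G̃∘∇*_ν ≤ A·e^{−δ|y−y′|_T}` at the spacing `L^{−K}` — FILE 83
`hasMaj_parametrix_comp_cut` with P-IIb's cut rows, P-IIj's lifted sandwiched entry-2 rows (the sandwich identity read through `mem_cubeW` from FILE 89's shifted-partition support), `|h| ≤ 1`,
`|∇h| ≤ π∕L^s ≤ π`, FILE 65's cut, the TRUE overlap `(L+1)^{d+1}`; `A, δ` free of `s, m_T, K`. [cite: Balaban1984PropagatorsII, (2.133), (2.136) p.247 (shapes + mechanism), (2.36)–(2.37) p.229;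
Balaban1985BackgroundPropagators, (3.42) p.397 (entry 2: shape); Balaban1984PropagatorsI, Prop. 1.2 (1.110) p.35] -/
theorem hasMaj_parametrix_divAdj_knitR (hL : Odd L ∧ 1 < L) {a : ℝ} (ha : 0 < a) :
    ∃ δ A : ℝ, 0 < δ ∧ 0 < A ∧ ∀ (s mT K : ℕ) (hs : s + 1 ≤ mT) (_hK : 1 ≤ K) (ν : Fin (d + 1)),
      HasMaj (BlockNorm.ofBlocks (unitTorusGeo L K (MP (paramsOf d L mT K hL)))
          (fun b : Tor (fine (L ^ K) (MP (paramsOf d L mT K hL))) × Fin (d + 1) => blockOf (L ^ K) (MP (paramsOf d L mT K hL)) b.1))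
        (BlockNorm.ofBlocks (unitTorusGeo L K (MP (paramsOf d L mT K hL)))
          (fun b : Tor (fine (L ^ K) (MP (paramsOf d L mT K hL))) × Fin (d + 1) => blockOf (L ^ K) (MP (paramsOf d L mT K hL)) b.1))
        (parametrix (knitHR d L s mT K (L ^ K) hL) (knitGR d L s mT K (L ^ K) hL hs a) ∘ₗ fgradAdj ((L ^ K : ℕ) : ℝ) (bshiftEquiv (MP (paramsOf d L mT K hL)) (L ^ K) ν))
        (fun y y' => A * Real.exp (-(δ * tdistT (MP (paramsOf d L mT K hL)) y y'))) := by
  have hL3 : 3 ≤ L := by obtain ⟨⟨j, hj⟩, h1⟩ := hL; omega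
  have hLpos : 0 < L := by omega
  obtain ⟨δ₀, C, hδ₀, hC, HG⟩ := hasMaj_chiCube_liftCubeG (d := d) hL ha
  obtain ⟨δT, βT, hδT, hβT, HT⟩ := hasMaj_transplant_gDivAdj_pair (d := d) hL ha
  set δ : ℝ := min δ₀ δT with hδ_def
  have hδ : 0 < δ := lt_min hδ₀ hδT
  set Nov : ℝ := (((L + 1) ^ (d + 1) : ℕ) : ℝ) with hNov_def
  refine ⟨δ, Nov * (βT * 1 + C * π) + 1, hδ, by positivity, fun s mT K hs hK ν => ?_⟩
  set M : Fin (d + 1) → ℕ := MP (paramsOf d L mT K hL) with hMdef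
  have hs' : s ≤ mT := by omega
  have hM : ∀ μ, M μ = 2 * L ^ (mT - s) * L ^ s := MP_eq_two_mul L s mT K hL hs'
  have hM2 : ∀ μ, MP (paramsOf d L (s + 1) K hL) μ = 2 * L ^ (s + 1) := fun μ => rfl
  have hw : 0 < L ^ s := pow_pos hLpos s
  have hn : 1 ≤ L ^ K := Nat.one_le_pow _ _ hLpos
  have hfit := coverMargin_fit hL3 s
  have hSe : L ^ (s + 1) = L * L ^ s := by rw [pow_succ, mul_comm]
  have hfit1 : coverMargin L s + 2 * L ^ s + 1 ≤ L ^ (s + 1) := by rw [hSe]; omega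
  have hS : L ^ (s + 1) ≤ 2 * L ^ (mT - s) * L ^ s := by
    calc L ^ (s + 1) ≤ L ^ mT := Nat.pow_le_pow_right hLpos hs
      _ = L ^ (mT - s) * L ^ s := by rw [← pow_add]; congr 1; omega
      _ ≤ 2 * L ^ (mT - s) * L ^ s := by rw [mul_assoc]; omega
  have hdiv : L ^ (s + 1) / L ^ s + 1 = L + 1 := by rw [hSe, Nat.mul_div_cancel _ hw]
  have hwR : (1 : ℝ) ≤ ((L ^ s : ℕ) : ℝ) := by exact_mod_cast hw
  have hind : ∀ (k : Fin (d + 1) → ZMod (2 * L ^ (mT - s))) (y y' : Tor M),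
      0 ≤ ind (g := unitTorusGeo L K M) ((cubeBlocks M (coverCorner M (L ^ s) (L ^ (mT - s)) (coverMargin L s) k) (L ^ (s + 1)) : Finset (Tor M)) : Set (Tor M)) y *
        ind (g := unitTorusGeo L K M) ((cubeBlocks M (coverCorner M (L ^ s) (L ^ (mT - s)) (coverMargin L s) k) (L ^ (s + 1)) : Finset (Tor M)) : Set (Tor M)) y' :=
    fun k y y' => mul_nonneg (ind_nonneg _ _) (ind_nonneg _ _)
  -- the cut rows and the lifted sandwiched entry-2 rows, rate weakened to `δ`
  have hGc : ∀ k : Fin (d + 1) → ZMod (2 * L ^ (mT - s)),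
      HasMaj (BlockNorm.ofBlocks (unitTorusGeo L K M) (fun b : Tor (fine (L ^ K) M) × Fin (d + 1) => blockOf (L ^ K) M b.1))
        (BlockNorm.ofBlocks (unitTorusGeo L K M) (fun b : Tor (fine (L ^ K) M) × Fin (d + 1) => blockOf (L ^ K) M b.1))
        (mulOp (chiCube M (L ^ K) (coverCorner M (L ^ s) (L ^ (mT - s)) (coverMargin L s) k) (L ^ (s + 1))) ∘ₗ knitGR d L s mT K (L ^ K) hL hs a k)
        (fun y y' => ind ((cubeBlocks M (coverCorner M (L ^ s) (L ^ (mT - s)) (coverMargin L s) k) (L ^ (s + 1)) : Finset (Tor M)) : Set (Tor M)) y *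
          ind ((cubeBlocks M (coverCorner M (L ^ s) (L ^ (mT - s)) (coverMargin L s) k) (L ^ (s + 1)) : Finset (Tor M)) : Set (Tor M)) y' * (C * Real.exp (-(δ * tdistT M y y')))) := fun k =>
    hasMaj_rate_le (hind k) hC.le (min_le_left _ _) (HG (s + 1) mT K hs hK (coverCorner M (L ^ s) (L ^ (mT - s)) (coverMargin L s) k))
  have hT2 : ∀ k : Fin (d + 1) → ZMod (2 * L ^ (mT - s)),
      HasMaj (BlockNorm.ofBlocks (unitTorusGeo L K M) (fun b : Tor (fine (L ^ K) M) × Fin (d + 1) => blockOf (L ^ K) M b.1))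
        (BlockNorm.ofBlocks (unitTorusGeo L K M) (fun b : Tor (fine (L ^ K) M) × Fin (d + 1) => blockOf (L ^ K) M b.1))
        (transplant (cubeW (L ^ K) (coverCorner M (L ^ s) (L ^ (mT - s)) (coverMargin L s) k) (L ^ (s + 1))) (redBond (L ^ K) (MP_dvd_MP hL hs K))
          (symOp (MP (paramsOf d L (s + 1) K hL)) (L ^ K) (torRed (MP_dvd_MP hL hs K) (coverCorner M (L ^ s) (L ^ (mT - s)) (coverMargin L s) k)) ∘ₗ
            (gOp (MP (paramsOf d L (s + 1) K hL)) (L ^ K) a ∘ₗ fgradAdj ((L ^ K : ℕ) : ℝ) (bshiftEquiv (MP (paramsOf d L (s + 1) K hL)) (L ^ K) ν)) ∘ₗ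
            mulOp (chiCube (MP (paramsOf d L (s + 1) K hL)) (L ^ K) (torRed (MP_dvd_MP hL hs K) (coverCorner M (L ^ s) (L ^ (mT - s)) (coverMargin L s) k)) (L ^ (s + 1)))))
        (fun y y' => ind ((cubeBlocks M (coverCorner M (L ^ s) (L ^ (mT - s)) (coverMargin L s) k) (L ^ (s + 1)) : Finset (Tor M)) : Set (Tor M)) y *
          ind ((cubeBlocks M (coverCorner M (L ^ s) (L ^ (mT - s)) (coverMargin L s) k) (L ^ (s + 1)) : Finset (Tor M)) : Set (Tor M)) y' * (βT * Real.exp (-(δ * tdistT M y y')))) := fun k => by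
    have h := (HT (s + 1) mT K 0 hs hK (coverCorner M (L ^ s) (L ^ (mT - s)) (coverMargin L s) k) ν).1
    rw [symbOp_sTinv_sub_one_eq] at h
    exact hasMaj_rate_le (hind k) hβT.le (min_le_right _ _) h
  -- the partition: Leibniz, cut, sandwiched identity, sizes, overlap
  have hχ := fun μ k => chiCube_coverCorner_eq_one_side (M := M) (n := L ^ K) (m₀ := coverMargin L s) hM hw hfit1 hS μ k
  have hleib : ∀ k : Fin (d + 1) → ZMod (2 * L ^ (mT - s)), mulOp (knitHR d L s mT K (L ^ K) hL k) ∘ₗ fgradAdj ((L ^ K : ℕ) : ℝ) (bshiftEquiv M (L ^ K) ν) =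
      fgradAdj ((L ^ K : ℕ) : ℝ) (bshiftEquiv M (L ^ K) ν) ∘ₗ mulOp (knitHR d L s mT K (L ^ K) hL k ∘ ⇑(bshiftEquiv M (L ^ K) ν)) +
        mulOp (fgrad ((L ^ K : ℕ) : ℝ) (bshiftEquiv M (L ^ K) ν) (knitHR d L s mT K (L ^ K) hL k)) := fun k => mulOp_comp_fgradAdj _ _ _
  have hcut : ∀ k : Fin (d + 1) → ZMod (2 * L ^ (mT - s)), mulOp (knitHR d L s mT K (L ^ K) hL k) ∘ₗ
      mulOp (chiCube M (L ^ K) (coverCorner M (L ^ s) (L ^ (mT - s)) (coverMargin L s) k) (L ^ (s + 1))) = mulOp (knitHR d L s mT K (L ^ K) hL k) := fun k =>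
    hcube_cut (2 * L ^ (mT - s)) (coverXi M (L ^ K) (L ^ s)) (bshiftEquiv M (L ^ K)) 0 (hχ 0 k)
  have hE2 : ∀ k : Fin (d + 1) → ZMod (2 * L ^ (mT - s)),
      mulOp (chiCube M (L ^ K) (coverCorner M (L ^ s) (L ^ (mT - s)) (coverMargin L s) k) (L ^ (s + 1))) ∘ₗ knitGR d L s mT K (L ^ K) hL hs a k ∘ₗ
          fgradAdj ((L ^ K : ℕ) : ℝ) (bshiftEquiv M (L ^ K) ν) ∘ₗ mulOp (knitHR d L s mT K (L ^ K) hL k ∘ ⇑(bshiftEquiv M (L ^ K) ν)) =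
        transplant (cubeW (L ^ K) (coverCorner M (L ^ s) (L ^ (mT - s)) (coverMargin L s) k) (L ^ (s + 1))) (redBond (L ^ K) (MP_dvd_MP hL hs K))
          (symOp (MP (paramsOf d L (s + 1) K hL)) (L ^ K) (torRed (MP_dvd_MP hL hs K) (coverCorner M (L ^ s) (L ^ (mT - s)) (coverMargin L s) k)) ∘ₗ
            (gOp (MP (paramsOf d L (s + 1) K hL)) (L ^ K) a ∘ₗ fgradAdj ((L ^ K : ℕ) : ℝ) (bshiftEquiv (MP (paramsOf d L (s + 1) K hL)) (L ^ K) ν)) ∘ₗ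
            mulOp (chiCube (MP (paramsOf d L (s + 1) K hL)) (L ^ K) (torRed (MP_dvd_MP hL hs K) (coverCorner M (L ^ s) (L ^ (mT - s)) (coverMargin L s) k)) (L ^ (s + 1)))) ∘ₗ
          mulOp (knitHR d L s mT K (L ^ K) hL k ∘ ⇑(bshiftEquiv M (L ^ K) ν)) := fun k => by
    have hg : ∀ b : Tor (fine (L ^ K) M) × Fin (d + 1), (knitHR d L s mT K (L ^ K) hL k ∘ ⇑(bshiftEquiv M (L ^ K) ν)) b ≠ 0 →
        b ∈ cubeW (L ^ K) (coverCorner M (L ^ s) (L ^ (mT - s)) (coverMargin L s) k) (L ^ (s + 1)) ∧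
          (b.1 + unitVec (fine (L ^ K) M) ν, b.2) ∈ cubeW (L ^ K) (coverCorner M (L ^ s) (L ^ (mT - s)) (coverMargin L s) k) (L ^ (s + 1)) := fun b hb => by
      have h := coverH_shift_support (m₀ := coverMargin L s) hM hw hfit1 hS ν k b hb
      exact ⟨(mem_cubeW b).mpr h.1, (mem_cubeW _).mpr h.2⟩
    have h := chiCube_liftCubeG_comp_divAdj_mulOp (L ^ K) (MP_dvd_MP hL hs K) (coverCorner M (L ^ s) (L ^ (mT - s)) (coverMargin L s) k) (L ^ (s + 1)) hM2 hn ha ν hg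
    rw [symbOp_sTinv_sub_one_eq, symbOp_sTinv_sub_one_eq] at h
    exact h
  have hh : ∀ (k : Fin (d + 1) → ZMod (2 * L ^ (mT - s))) x, |knitHR d L s mT K (L ^ K) hL k x| ≤ 1 := fun k x => abs_coverH_le_one k x
  have hhs : ∀ (k : Fin (d + 1) → ZMod (2 * L ^ (mT - s))) x, |(knitHR d L s mT K (L ^ K) hL k ∘ ⇑(bshiftEquiv M (L ^ K) ν)) x| ≤ 1 :=
    fun k x => abs_coverH_le_one k (bshiftEquiv M (L ^ K) ν x)
  have hdh : ∀ (k : Fin (d + 1) → ZMod (2 * L ^ (mT - s))) x, |fgrad ((L ^ K : ℕ) : ℝ) (bshiftEquiv M (L ^ K) ν) (knitHR d L s mT K (L ^ K) hL k) x| ≤ π / ((L ^ s : ℕ) : ℝ) :=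
    fun k x => abs_fgrad_coverH_le hM hw k ν x
  have hN : ∀ y : Tor M, ∑ k : Fin (d + 1) → ZMod (2 * L ^ (mT - s)),
      ind (g := unitTorusGeo L K M) ((cubeBlocks M (coverCorner M (L ^ s) (L ^ (mT - s)) (coverMargin L s) k) (L ^ (s + 1)) : Finset _) : Set _) y ≤ Nov := fun y => by
    have h := sum_ind_cubeBlocks_le_overlap (S := L ^ (s + 1)) (m₀ := coverMargin L s) hM hw L K y
    rw [hdiv] at h
    exact h
  -- FILE 83
  have key := hasMaj_parametrix_comp_cut (g := unitTorusGeo L K M) (fun b : Tor (fine (L ^ K) M) × Fin (d + 1) => blockOf (L ^ K) M b.1)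
    (fun k => ((cubeBlocks M (coverCorner M (L ^ s) (L ^ (mT - s)) (coverMargin L s) k) (L ^ (s + 1)) : Finset (Tor M)) : Set (Tor M))) (E := fgradAdj ((L ^ K : ℕ) : ℝ) (bshiftEquiv M (L ^ K) ν))
    (G := knitGR d L s mT K (L ^ K) hL hs a) hC.le hβT.le zero_le_one (by positivity : (0 : ℝ) ≤ π / ((L ^ s : ℕ) : ℝ)) hleib hcut hE2 hh hhs hdh hN hGc hT2
  refine key.mono fun y y' => mul_le_mul_of_nonneg_right ?_ (Real.exp_nonneg _)
  have hπw : C * (π / ((L ^ s : ℕ) : ℝ)) ≤ C * π := mul_le_mul_of_nonneg_left (div_le_self Real.pi_pos.le hwR) hC.le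
  have h2 : Nov * (βT * 1 + C * (π / ((L ^ s : ℕ) : ℝ))) ≤ Nov * (βT * 1 + C * π) := mul_le_mul_of_nonneg_left (by linarith) (by positivity)
  linarith

end OneGrid

end Summit.QuantumFields.YangMills.BalabanUVNodes.N15.Gluing

end
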